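import Literature.Computability.AlgebraicComplexity.SmallFormatRankProofs
import Literature.Computability.AlgebraicComplexity.MatMul666Rank153MoosbauerPoole
import HarnessLib

/-!
# ω-census family (a): the kernel-certified rank WINDOW `76 ≤ R(⟨6,6,6⟩) ≤ 153` over every field

Cell `pub-omega` (HOME `run/shared/lean/pub/pub-omega/`, unit `pub-omega-lit`), topic
`Summits/MatrixMultiplication/OmegaCensus`; sibling of `RankWindows.lean` (all formats `≤ 5`).
Framing (verbatim): lottery ticket; floor = certified bounds/negative ranges. HONEST FRAMING: this
file proves NOTHING new — it assembles the two ends that are ALREADY kernel theorems in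
`Literature/` so that the census table (`OMEGA-TABLE.md` row R277) can cite one declaration:

* lower `76`: Bläser 2003, Theorem 14 (`R(⟨n,m,n⟩) ≥ 2mn + 2n − m − 2`, `m ≥ n ≥ 3`) at
  `m = n = 6`: `72 + 12 − 6 − 2 = 76` — the tree's PROVED `blaser2003_thm14_holds`
  (`SmallFormatRankProofs.lean`).  (Bläser's `5/2·n² − 3n = 72` and Landsberg–Michałek-type border
  rank bounds are weaker at `n = 6`; `76` is the best printed rank lower bound for `6 × 6` we know.)
* upper `153`: Moosbauer–Poole 2025, the explicit scheme kernel-checked in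
  `MatMul666Rank153MoosbauerPoole.lean` (`tensorRank_matMulTensor_666_le`, every commutative ring).

| format | window (every field) | print |
|---|---|---|
| 666 | [76, 153] | [76, 153] (Bläser 2003 Thm 14; Moosbauer–Poole 2025, previous upper 160 Smirnov 2013) |
-/

namespace Summit.MatrixMultiplication.OmegaCensus

open Literature.Computability.AlgebraicComplexity

namespace RankWindows

variable (K : Type) [Field K]

/-- `76 ≤ R(⟨6,6,6⟩)` over every field: Bläser 2003 Thm. 14 at `m = n = 6`
(`2·6·6 + 2·6 − 6 − 2 = 76`). [cite: Blaser2003, Theorem 14 (m = n = 6)] -/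
theorem seventysix_le_tensorRank_matMulTensor_666 : 76 ≤ tensorRank (matMulTensor K 6 6 6) := by
  simpa using blaser2003_thm14_holds K 6 6 (by norm_num) le_rfl

/-- `76 ≤ R(⟨6,6,6⟩) ≤ 153` over every field (Bläser 2003 Thm. 14; Moosbauer–Poole 2025).
[cite: Blaser2003, Theorem 14] [cite: MoosbauerPoole2025, abstract and §1 (⟨6,6,6⟩: 153)] -/
theorem window_666 : tensorRank (matMulTensor K 6 6 6) ∈ Set.Icc 76 153 :=
  ⟨seventysix_le_tensorRank_matMulTensor_666 K, tensorRank_matMulTensor_666_le K⟩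

end RankWindows

end Summit.MatrixMultiplication.OmegaCensus
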